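import Summits.BirchSwinnertonDyer.BirchSwinnertonDyer.Theorems.SylvesterTwoHeegnerIndexUpperOffV0ShaBoundTwo
import Summits.BirchSwinnertonDyer.BirchSwinnertonDyer.Theorems.SylvesterTwoHeegnerIndexFrameConstants
import HarnessLib

/-!
# K7t crux `UpperOffV0HSY` (item 19581): what the registered stubs (d) + (e) give IN KERNEL for the
# Sylvester curves `E_p` — `Ш(E_p/K)[2^∞]` finite and killed by `2^{2M₀+4}`

Route `SylvesterTwoHeegnerIndex` (cell bsd-cm, rung K7t), line `offv0-kolyvagin2` on
stmt-BirchSwinnertonDyer-19581, whose registered skeleton (k7t-c2 g3) has the open stubs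
(d) `stub_kolyvaginClasses_two`, (e) `stub_kolyvaginReciprocity_two`, and (f)+(g)
`stub_upperOffV0_of_kolyvaginDescent_two : (d) → (e) → ¬¬ UpperOffV0HSY`.  This file takes the TEXTS
of (d) and (e) VERBATIM as hypotheses and derives, for every `ℚ`-model `W` of a cube-sum curve
`E_p = cubeSumCurve p` (`p` an odd prime), every imaginary quadratic `K` with `d_K ∉ {-3, -4}`,
`ω ∉ K` and the Heegner hypothesis, and every Heegner point `P ∈ E_p(K)` of level `N` of infinite
order: **`Ш(E_p/K)[2^∞]` is finite and `2^{2M₀+4} · Ш(E_p/K)[2^∞] = 0`**, `2^{M₀} ∥ P` in `E_p(K)`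
(`sha_two_exponent_bound_sylvester_of_stubs`).  Inputs discharged here: `E_p(K)[2] = 0`
(`SylvesterTwoFrame.two_torsion_eq_zero_of_model_of_isImaginaryQuadratic`, x1b) and `∛(432p²) ∉ K`
(`SylvesterTwoFrame.cube_ne_432_mul_sq_of_finrank_eq_two`); everything else is this seat's chain
(`sha_two_primary_exponent_of_pointsM_of_reciprocityM`).

So, in kernel terms, the XL stub splits as: (d) + (e) ⟹ [this file] the EXPONENT bound with defect
`4`; and (g) := «exponent `2M₀ + 4` ⟹ ORDER `ord₂ #Ш(E_p/K)[2^∞] ≤ 2M₀`» — the crux proper, for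
which no source exists (B14 = O12 open as a class).  Nothing here advances BSD; no named fact, no
definition.
-/

noncomputable section

open scoped Classical
open WeierstrassCurve NumberField IsDedekindDomain Field Literature.NumberTheory.EllipticCurves
  Literature.NumberTheory.GaloisRepresentations

set_option autoImplicit false
set_option linter.dupNamespace false

namespace Summit.BirchSwinnertonDyer.BirchSwinnertonDyer.Theorems.SylvesterTwoUpper

/-- **(d) + (e) ⟹ `2^{2M₀+4} Ш(E_p/K)[2^∞] = 0` for the Sylvester curves.**  The hypotheses `hD`,
`hE` are the registered signatures of `stub_kolyvaginClasses_two` and `stub_kolyvaginReciprocity_two`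
VERBATIM; the conclusion is Kolyvagin's theorem at `p = 2` in exponent form with the generic 2-adic
defect (`sha_two_primary_exponent_of_pointsM_of_reciprocityM`), for every `ℚ`-model `W` of
`cubeSumCurve p` (`p` an odd prime), every imaginary quadratic Heegner field `K` with
`d_K ∉ {-3, -4}` and `ω ∉ K`, and every Heegner point `P` of infinite order: `2^{M₀} ∥ P` in `E_p(K)`,
`Ш(E_p/K)[2^∞]` is finite and killed by `2^{2M₀+4}`. [cite: McCallumLMS1991, §1 Theorem (Kolyvagin)]
[cite: GrossLMS1991, Thm. 1.3 (2)] -/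
theorem sha_two_exponent_bound_sylvester_of_stubs
    (hD : ∀ (N : ℕ) [NeZero N] (W : WeierstrassCurve ℚ) [W.IsElliptic] (K : Type) [Field K]
      [NumberField K] (_hK : IsImaginaryQuadratic K)
      (_hD : NumberField.discr K ≠ -3 ∧ NumberField.discr K ≠ -4)
      (_hH : SatisfiesHeegnerHypothesis N K) {P : (W.baseChange K).toAffine.Point}
      (_hP : IsHeegnerPoint N W K P) (_hnt : ¬ IsOfFinAddOrder P) {M : ℕ} (_hM : 1 ≤ M)
      (hdiv : ∀ Q : geomPoints (W.baseChange K), ∃ R, ((2 ^ M : ℕ) : ℤ) • R = Q)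
      (c : K ≃ₐ[ℚ] K) (_hc : c ≠ 1),
      ∃ (ε : ℤ) (τ : AlgebraicClosure K ≃+* AlgebraicClosure K) (hτ : IsLiftOfAut c τ)
        (A : ℕ → AddSubgroup (geomPoints (W.baseChange K)))
        (hA : ∀ m, KolyvaginCocycle.IsAdmissible (Field.absoluteGaloisGroup K) (A m)
          ((2 ^ M : ℕ) : ℤ))
        (Pt : ℕ → geomPoints (W.baseChange K))
        (hPt : ∀ m, Pt m ∈
          KolyvaginCocycle.invPoints (Field.absoluteGaloisGroup K) (A m) ((2 ^ M : ℕ) : ℤ)),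
        (ε = 1 ∨ ε = -1) ∧
        IsOfFinAddOrder (Affine.Point.map (W' := W) (c : K →ₐ[ℚ] K) P - ε • P) ∧
        (∀ m, ∀ a ∈ A m, hτ.pointsMap W a ∈ A m) ∧ Pt 1 = toGeomPoints (W.baseChange K) P ∧
        (∀ m : ℕ, Squarefree m →
          (∀ q ∈ m.primeFactors, IsKolyvaginPrime N W K 2 q ∧ FrobEqFrobInfty W K (2 ^ M) q) →
          (∃ B ∈ A m, hτ.pointsMap W (Pt m) =
            (ε * (-1) ^ m.primeFactors.card) • Pt m + ((2 ^ M : ℕ) : ℤ) • B) ∧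
          (∀ v : HeightOneSpectrum (𝓞 K), (m : 𝓞 K) ∉ v.asIdeal →
            kolyvaginClass (W.baseChange K) _ hdiv (hA m) (Pt m) (hPt m) ∈
              selmerLocalKer (W.baseChange K) (v.adicCompletion K) ((2 ^ M : ℕ) : ℤ)) ∧
          (∀ ℓ : ℕ, ℓ.Prime → ℓ ∣ m → ∀ v : HeightOneSpectrum (𝓞 K), (ℓ : 𝓞 K) ∈ v.asIdeal →
            ∀ a : ℕ, ((((2 : ℕ) : ℤ) ^ a) •
                kolyvaginClass (W.baseChange K) _ hdiv (hA m) (Pt m) (hPt m) ∈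
                selmerLocalKer (W.baseChange K) (v.adicCompletion K) ((2 ^ M : ℕ) : ℤ) ↔
              (((2 : ℕ) : ℤ) ^ a) • kolyvaginClass (W.baseChange K) _ hdiv (hA (m / ℓ))
                  (Pt (m / ℓ)) (hPt (m / ℓ)) ∈
                (W.baseChange K).torsionLocalKer (v.adicCompletion K) ((2 ^ M : ℕ) : ℤ)))))
    (hE : ∀ (N : ℕ) [NeZero N] (W : WeierstrassCurve ℚ) [W.IsElliptic] (K : Type) [Field K]
      [NumberField K] (_hK : IsImaginaryQuadratic K)
      (_hD : NumberField.discr K ≠ -3 ∧ NumberField.discr K ≠ -4)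
      (_hH : SatisfiesHeegnerHypothesis N K) {P : (W.baseChange K).toAffine.Point}
      (_hP : IsHeegnerPoint N W K P) (_hnt : ¬ IsOfFinAddOrder P) {M : ℕ} (_hM : 1 ≤ M) {ℓ : ℕ}
      (hℓ : IsKolyvaginPrime N W K 2 ℓ), FrobEqFrobInfty W K (2 ^ M) ℓ →
      ∃ (A : Type) (_ : AddCommGroup A)
        (e : geomTorsion (W.baseChange K) ((2 ^ M : ℕ) : ℤ) →+
          geomTorsion (W.baseChange K) ((2 ^ M : ℕ) : ℤ) →+ A),
        (∀ x, e x x = 0) ∧ (∀ x, (∀ y, e x y = 0) → x = 0) ∧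
        ∀ s ∈ selmerGroup (W.baseChange K) ((2 ^ M : ℕ) : ℤ),
          ∀ c' : galH1Torsion (W.baseChange K) ((2 ^ M : ℕ) : ℤ),
          (∀ v : HeightOneSpectrum (𝓞 K), (ℓ : 𝓞 K) ∉ v.asIdeal →
            c' ∈ selmerLocalKer (W.baseChange K) (v.adicCompletion K) ((2 ^ M : ℕ) : ℤ)) →
          (∀ w : InfinitePlace K,
            c' ∈ selmerLocalKer (W.baseChange K) w.Completion ((2 ^ M : ℕ) : ℤ)) →
          ∀ 𝔔 ∈ hℓ.place.primesAbove, ∀ F : Field.absoluteGaloisGroup K,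
            IsArithFrobAt (𝓞 K) F 𝔔 → F ∈ torsionFixing (W.baseChange K) ((2 ^ M : ℕ) : ℤ) →
            ∀ σ ∈ 𝔔.inertia (Field.absoluteGaloisGroup K),
            e (h1Eval (W.baseChange K) ((2 ^ M : ℕ) : ℤ) s F)
              (h1Eval (W.baseChange K) ((2 ^ M : ℕ) : ℤ) c' σ) = 0)
    {p : ℕ} (hp : p.Prime) (hp2 : p ≠ 2) {N : ℕ} [NeZero N] (W : WeierstrassCurve ℚ) [W.IsElliptic]
    (hW : ∃ C : VariableChange ℚ, C • W = HuShuYin2019.cubeSumCurve (p : ℚ))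
    {K : Type} [Field K] [NumberField K] (hK : IsImaginaryQuadratic K)
    (hdK : NumberField.discr K ≠ -3 ∧ NumberField.discr K ≠ -4) (hH : SatisfiesHeegnerHypothesis N K)
    (hωK : ∀ x : K, x ^ 2 + x + 1 ≠ 0)
    {P : (W.baseChange K).toAffine.Point} (hP : IsHeegnerPoint N W K P) (hnt : ¬ IsOfFinAddOrder P) :
    ∃ (M₀ : ℕ) (x₀ : (W.baseChange K).toAffine.Point),
      2 ^ M₀ • x₀ = P ∧ (∀ Q : (W.baseChange K).toAffine.Point, 2 ^ (M₀ + 1) • Q ≠ P) ∧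
      (∀ cs : (W.baseChange K).sha, (∃ j : ℕ, 2 ^ j • cs = 0) → 2 ^ (2 * M₀ + 4) • cs = 0) ∧
      Set.Finite {cs : (W.baseChange K).sha | ∃ j : ℕ, 2 ^ j • cs = 0} := by
  -- the Mordell model `C • W = y² = x³ − 432p²`, `∛(432p²) ∉ K`, `E_p(K)[2] = 0`
  obtain ⟨C, hCW⟩ := hW
  have hCW' : C • W = ⟨0, 0, 0, 0, -(432 * (p : ℚ) ^ 2)⟩ := by
    rw [hCW, HuShuYin2019.cubeSumCurve]; congr 1; ring
  have hcube : ∀ x : K, x ^ 3 ≠ ((432 * (p : ℚ) ^ 2 : ℚ) : K) := fun x h =>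
    SylvesterTwoFrame.cube_ne_432_mul_sq_of_finrank_eq_two K hK.1 hp hp2 x (by rw [h]; simp)
  have hA2 : ∀ a : (W.baseChange K).toAffine.Point, 2 • a = 0 → a = 0 :=
    SylvesterTwoFrame.two_torsion_eq_zero_of_model_of_isImaginaryQuadratic K hK hp hp2 W ⟨C, hCW⟩
  exact sha_two_primary_exponent_of_pointsM_of_reciprocityM (N := N) W hK hCW' hcube hωK hA2 hP hnt
    (fun {M} hM hdiv c hc ↦ hD N W K hK hdK hH hP hnt hM hdiv c hc)
    (fun {M} hM {ℓ} hℓ hℓM ↦ hE N W K hK hdK hH hP hnt hM hℓ hℓM)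

end Summit.BirchSwinnertonDyer.BirchSwinnertonDyer.Theorems.SylvesterTwoUpper

end
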